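import Literature.Analysis.PDE.NewtonianKernel
import Literature.Analysis.FluidPDE.HarmonicProbe
import Literature.Analysis.FluidPDE.NewtonKernel
import Mathlib.Analysis.Calculus.UniformLimitsDeriv
import HarnessLib

/-!
# The Newtonian kernel of a finite-dimensional real inner product space (`n ≥ 3`), II:
# the approximate identity and the Newtonian potential

Analysis/PDE support file (definitions with bodies and PROVED theorems only; no named facts),
continuation of `NewtonianKernel.lean` on the discharge path of
`Literature.Analysis.PDE.LoewnerNirenberg.exists_isMaximalSolution` (the local solver of the
Perron construction is `z = P[φ] + N[f(z)] - P[N[f(z)]]`, `N` the Newtonian potential).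

* **Approximate identity** (`kernel`, `approxId` of `NewtonianKernel.lean`): the mass of
  `ρ_{ε²}` off any ball tends to `0` as `ε → 0⁺` (`setIntegral_approxId_sq_compl_ball`,
  `tendsto_setIntegral_compl_ball_atTop`), whence **`∫ g(z) ρ_{ε²}(x - z) dz → g(x)`** for
  bounded uniformly continuous `g` (`tendsto_integral_mul_approxId`).
* **The potentials** `Newtonian.potential a g x = ∫ g z · kernel a (x - z) dz`; `a = 0` is THE
  NEWTONIAN POTENTIAL `N g = Γ * g`, `a > 0` its smooth regularisations `N_a g` (smooth by the
  kernel-side differentiation lemmas of `FluidPDE/HarmonicProbe`, with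
  `Δ (N_a g)(x) = ∫ g z ρ_a(x - z) dz`, `laplacian_potential_pos`); sup bounds
  `|N_a g x| ≤ C R² M` for `|g| ≤ M` supported in `B̄(c, R)` (`abs_potential_le`).
* the gradient bound `‖∫ g(z) • DΓ_a(x - z) dz‖ ≤ C R M` (`norm_potentialGrad_le`);
* **N4**: `N g` is smooth and harmonic off the support of `g`
  (`laplacian_potential_eq_zero_of_forall_eq_zero`, via the globally smooth modification
  `kernelFloor` of `Γ` agreeing with it away from the origin).

N1–N3 (`N g ∈ C¹`, `Δ N g = g` for `g ∈ C²_c`, `N g ∈ C²` for `g ∈ C¹_c`) are in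
`NewtonianPotentialRegularity.lean`.

## References

* D. Gilbarg, N. S. Trudinger, *Elliptic Partial Differential Equations of Second Order*
  (Springer 2001), §2.4 (2.12), §4.1 Lemmas 4.1–4.2. [GilbargTrudinger2001]
-/

noncomputable section

open MeasureTheory Metric Set Filter Function Module InnerProductSpace
open scoped Laplacian RealInnerProductSpace Topology ContDiff

namespace Literature.Analysis.PDE

namespace Newtonian

variable {E : Type*} [NormedAddCommGroup E] [InnerProductSpace ℝ E] [FiniteDimensional ℝ E]
  [MeasurableSpace E] [BorelSpace E]

/-! ### Tails of the approximate identity -/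

/-- Scaling of the tails: the mass of `ρ_{ε²}` off `B(0, δ)` is the mass of `ρ₁` off
`B(0, δ/ε)`. [folklore] -/
theorem setIntegral_approxId_sq_compl_ball {ε : ℝ} (hε : 0 < ε) (δ : ℝ) :
    ∫ ξ in (ball (0 : E) δ)ᶜ, approxId (ε ^ 2) ξ = ∫ u in (ball (0 : E) (δ / ε))ᶜ, approxId 1 u := by
  set G : E → ℝ := (ball (0 : E) (δ / ε))ᶜ.indicator (approxId 1) with hG
  have h1 : ∀ ξ : E, (ball (0 : E) δ)ᶜ.indicator (approxId (ε ^ 2)) ξ =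
      (ε ^ finrank ℝ E)⁻¹ * G (ε⁻¹ • ξ) := by
    intro ξ
    have hmem : ξ ∈ (ball (0 : E) δ)ᶜ ↔ ε⁻¹ • ξ ∈ (ball (0 : E) (δ / ε))ᶜ := by
      simp only [mem_compl_iff, mem_ball_zero_iff, not_lt, norm_smul, norm_inv, Real.norm_eq_abs,
        abs_of_pos hε]
      rw [div_le_iff₀ hε, inv_mul_eq_div, div_mul_cancel₀ _ hε.ne']
    by_cases h : ξ ∈ (ball (0 : E) δ)ᶜ
    · rw [indicator_of_mem h, hG, indicator_of_mem (hmem.1 h)]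
      simp only [approxId, regBump_sq hε]
      ring
    · rw [indicator_of_notMem h, hG, indicator_of_notMem (fun h' => h (hmem.2 h')), mul_zero]
  rw [← integral_indicator measurableSet_ball.compl, ← integral_indicator measurableSet_ball.compl]
  simp_rw [h1]
  rw [integral_const_mul, Measure.integral_comp_smul volume G ε⁻¹, inv_pow, inv_inv,
    abs_of_pos (by positivity), smul_eq_mul, ← mul_assoc, inv_mul_cancel₀ (by positivity), one_mul]

/-- The mass of an integrable function off the ball `B(0, R)` tends to `0` as `R → ∞`.
[folklore] -/
theorem tendsto_setIntegral_compl_ball_atTop {f : E → ℝ} (hf : Integrable f) :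
    Tendsto (fun R : ℝ => ∫ ξ in (ball (0 : E) R)ᶜ, f ξ) atTop (𝓝 0) := by
  have hmono : Monotone fun R : ℝ => ball (0 : E) R := fun _ _ h => ball_subset_ball h
  have hU : (⋃ R : ℝ, ball (0 : E) R) = univ := by
    refine eq_univ_of_forall fun ξ => mem_iUnion.2 ⟨‖ξ‖ + 1, ?_⟩
    rw [mem_ball_zero_iff]; linarith
  have h1 : Tendsto (fun R : ℝ => ∫ ξ in ball (0 : E) R, f ξ) atTop (𝓝 (∫ ξ, f ξ)) := by
    have := tendsto_setIntegral_of_monotone (μ := volume) (fun R => measurableSet_ball) hmono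
      (by rw [hU]; exact hf.integrableOn)
    rwa [hU, setIntegral_univ] at this
  have h2 : ∀ R : ℝ, ∫ ξ in (ball (0 : E) R)ᶜ, f ξ = (∫ ξ, f ξ) - ∫ ξ in ball (0 : E) R, f ξ := by
    intro R
    rw [← integral_add_compl (μ := volume) measurableSet_ball hf]
    ring
  simp_rw [h2]
  simpa using (tendsto_const_nhds (x := ∫ ξ, f ξ)).sub h1

/-- **Small tails**: for `δ > 0` and `η > 0` there is `ε₀ > 0` with
`∫_{‖ξ‖ ≥ δ} ρ_{ε²} < η` for all `0 < ε < ε₀`. [folklore] -/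
theorem exists_setIntegral_approxId_sq_compl_ball_lt {δ : ℝ} (hδ : 0 < δ)
    {η : ℝ} (hη : 0 < η) :
    ∃ ε₀ : ℝ, 0 < ε₀ ∧ ∀ ε : ℝ, 0 < ε → ε < ε₀ →
      ∫ ξ in (ball (0 : E) δ)ᶜ, approxId (ε ^ 2) ξ < η := by
  have hint : Integrable (approxId 1 : E → ℝ) := by
    have := integrable_approxId_sq (E := E) one_pos
    rwa [one_pow] at this
  have ht := tendsto_setIntegral_compl_ball_atTop hint
  obtain ⟨R₀, hR₀⟩ := (Filter.tendsto_atTop'.1 ht) (Iio η) (Iio_mem_nhds hη)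
  refine ⟨δ / (max R₀ 1 + 1), by positivity, fun ε hε hεlt => ?_⟩
  rw [setIntegral_approxId_sq_compl_ball hε δ]
  have hR : R₀ < δ / ε := by
    rw [lt_div_iff₀ hε]
    have h1 : ε * (max R₀ 1 + 1) < δ := by rwa [lt_div_iff₀ (by positivity)] at hεlt
    have h2 : R₀ * ε ≤ (max R₀ 1 + 1) * ε := by
      refine mul_le_mul_of_nonneg_right ?_ hε.le
      linarith [le_max_left R₀ 1]
    linarith [mul_comm ε (max R₀ 1 + 1)]
  exact hR₀ _ hR.le

/-! ### Convergence of the approximate identity -/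

/-- **The approximate identity converges**: for a bounded, uniformly continuous, continuous
`g : E → ℝ` and every `x`, `∫ g(z) ρ_{ε²}(x - z) dz → g(x)` as `ε → 0⁺` (`n ≥ 3`). [folklore] -/
theorem tendsto_integral_mul_approxId (hn : 3 ≤ finrank ℝ E) {g : E → ℝ} (hgc : Continuous g)
    (hgu : UniformContinuous g) {M : ℝ} (hM : ∀ z, |g z| ≤ M) (x : E) :
    Tendsto (fun ε : ℝ => ∫ z, g z * approxId (ε ^ 2) (x - z)) (𝓝[>] 0) (𝓝 (g x)) := by
  have hM0 : 0 ≤ M := (abs_nonneg _).trans (hM x)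
  rw [Metric.tendsto_nhdsWithin_nhds]
  intro η hη
  -- uniform continuity scale `δ`
  obtain ⟨δ, hδ, hδg⟩ := Metric.uniformContinuous_iff.1 hgu (η / 2) (by positivity)
  -- small tails below `ε₀`
  obtain ⟨ε₀, hε₀, htail⟩ := exists_setIntegral_approxId_sq_compl_ball_lt (E := E) hδ
    (η := η / (4 * (M + 1))) (by positivity)
  refine ⟨ε₀, hε₀, fun ε hε hεd => ?_⟩
  have hε' : 0 < ε := hε
  have hεlt : ε < ε₀ := by
    rw [Real.dist_eq, sub_zero, abs_of_pos hε'] at hεd; exact hεd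
  set ρ : E → ℝ := approxId (ε ^ 2) with hρ
  have hρi : Integrable ρ := integrable_approxId_sq hε'
  have hρ0 : ∀ t, 0 ≤ ρ t := fun t => approxId_nonneg hn (by positivity) t
  have hρ1 : ∫ t, ρ t = 1 := integral_approxId_sq hn hε'
  have hgm : AEStronglyMeasurable g volume := hgc.aestronglyMeasurable
  -- Step 1: `∫ g z ρ(x - z) dz - g x = ∫ (g (x - t) - g x) ρ t dt`
  have hI1 : Integrable fun z : E => g z * ρ (x - z) := by
    refine (hρi.comp_sub_left x).bdd_mul (c := M) hgm (Eventually.of_forall fun z => ?_)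
    rw [Real.norm_eq_abs]; exact hM z
  have hI2 : Integrable fun z : E => g x * ρ (x - z) := (hρi.comp_sub_left x).const_mul _
  have hdiff : (∫ z, g z * ρ (x - z)) - g x = ∫ t, (g (x - t) - g x) * ρ t := by
    have h2 : ∫ z, (g z - g x) * ρ (x - z) = (∫ z, g z * ρ (x - z)) - g x := by
      have e : (fun z => (g z - g x) * ρ (x - z)) = fun z => g z * ρ (x - z) - g x * ρ (x - z) := by
        funext z; ring
      rw [e, integral_sub hI1 hI2, integral_const_mul, integral_sub_left_eq_self ρ volume x, hρ1,
        mul_one]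
    rw [← h2]
    have h3 := integral_sub_left_eq_self (fun t => (g (x - t) - g x) * ρ t) volume x
    simp only [sub_sub_cancel] at h3
    exact h3
  rw [Real.dist_eq, hdiff]
  -- Step 2: pointwise bound `|g(x-t) - g x| ρ t ≤ (η/2) ρ t + 2M 1_{‖t‖ ≥ δ} ρ t`
  set ind : E → ℝ := (ball (0 : E) δ)ᶜ.indicator ρ with hind
  have hbound : ∀ t, |(g (x - t) - g x) * ρ t| ≤ η / 2 * ρ t + 2 * M * ind t := by
    intro t
    rw [abs_mul, abs_of_nonneg (hρ0 t)]
    by_cases ht : ‖t‖ < δ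
    · have h1 : |g (x - t) - g x| < η / 2 := by
        have := hδg (a := x - t) (b := x) (by rwa [dist_eq_norm, sub_sub_cancel_left, norm_neg])
        rwa [Real.dist_eq] at this
      have h2 : 0 ≤ 2 * M * ind t := by
        have : 0 ≤ ind t := by
          rw [hind]; exact indicator_nonneg (fun s _ => hρ0 s) t
        positivity
      nlinarith [hρ0 t]
    · have hmem : t ∈ (ball (0 : E) δ)ᶜ := by simpa [mem_ball_zero_iff] using ht
      have h1 : ind t = ρ t := by rw [hind, indicator_of_mem hmem]
      have h2 : |g (x - t) - g x| ≤ 2 * M := by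
        calc |g (x - t) - g x| ≤ |g (x - t)| + |g x| := abs_sub _ _
          _ ≤ M + M := add_le_add (hM _) (hM _)
          _ = 2 * M := by ring
      rw [h1]
      nlinarith [hρ0 t]
  have hIind : Integrable ind := hρi.indicator measurableSet_ball.compl
  have hIF : Integrable fun t : E => (g (x - t) - g x) * ρ t := by
    refine hρi.bdd_mul (c := 2 * M) ?_ (Eventually.of_forall fun t => ?_)
    · exact (hgc.comp (continuous_const.sub continuous_id)).aestronglyMeasurable.sub
        aestronglyMeasurable_const
    · rw [Real.norm_eq_abs]
      calc |g (x - t) - g x| ≤ |g (x - t)| + |g x| := abs_sub _ _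
        _ ≤ M + M := add_le_add (hM _) (hM _)
        _ = 2 * M := by ring
  calc |∫ t, (g (x - t) - g x) * ρ t| ≤ ∫ t, |(g (x - t) - g x) * ρ t| := abs_integral_le_integral_abs
    _ ≤ ∫ t, (η / 2 * ρ t + 2 * M * ind t) :=
        integral_mono hIF.abs ((hρi.const_mul _).add (hIind.const_mul _)) hbound
    _ = η / 2 * 1 + 2 * M * ∫ t in (ball (0 : E) δ)ᶜ, ρ t := by
        rw [integral_add (hρi.const_mul _) (hIind.const_mul _), integral_const_mul,
          integral_const_mul, hρ1, hind, integral_indicator measurableSet_ball.compl]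
    _ ≤ η / 2 * 1 + 2 * M * (η / (4 * (M + 1))) := by
        have := (htail ε hε' hεlt).le
        nlinarith
    _ < η := by
        have hM1 : 0 < M + 1 := by linarith
        have h1 : 2 * M * (η / (4 * (M + 1))) = η / 2 * (M / (M + 1)) := by
          field_simp
          ring
        have h2 : M / (M + 1) < 1 := by rw [div_lt_one hM1]; linarith
        have h3 : η / 2 * (M / (M + 1)) < η / 2 * 1 := by gcongr
        linarith


/-! ### The potentials -/

/-- **The (regularised) Newtonian potentials** `N_a g (x) = ∫ g(z) Γ_a(x - z) dz`; for `a = 0`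
this is THE NEWTONIAN POTENTIAL `N g = Γ * g` of the density `g` (Gilbarg–Trudinger (4.1)),
for `a > 0` its smooth regularisation. [folklore] -/
def potential (a : ℝ) (g : E → ℝ) (x : E) : ℝ := ∫ z, g z * kernel a (x - z)

/-- The gradient potentials `∫ g(z) • DΓ_a(x - z) dz` (the derivative of `N_a g`,
Gilbarg–Trudinger (4.3)). [folklore] -/
def potentialGrad (a : ℝ) (g : E → ℝ) (x : E) : E →L[ℝ] ℝ :=
  ∫ z, g z • fderiv ℝ (kernel a : E → ℝ) (x - z)

/-- Reflection-translation in the potential integrals: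
`∫ g(z) K(x - z) dz = ∫ g(x - t) K(t) dt`. [folklore] -/
theorem integral_mul_comp_sub_swap (g K : E → ℝ) (x : E) :
    ∫ z, g z * K (x - z) = ∫ t, g (x - t) * K t := by
  have h := integral_sub_left_eq_self (fun t => g (x - t) * K t) volume x
  simp only [sub_sub_cancel] at h
  exact h

omit [InnerProductSpace ℝ E] [FiniteDimensional ℝ E] [MeasurableSpace E] [BorelSpace E] in
/-- A density supported in the ball `B(c, R)` vanishes for `‖z‖ > ‖c‖ + R`. [folklore] -/
theorem eq_zero_of_norm_gt {g : E → ℝ} {c : E} {R : ℝ} (hsupp : ∀ z ∉ ball c R, g z = 0)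
    {z : E} (hz : ‖c‖ + R < ‖z‖) : g z = 0 := by
  refine hsupp z fun h => ?_
  rw [mem_ball, dist_eq_norm] at h
  have := norm_le_norm_add_norm_sub' z c
  linarith

/-! ### The regularised potentials are smooth -/

section Regularised

variable {g : E → ℝ} {c : E} {R M a : ℝ}

/-- For `a > 0` and an integrable density supported in a ball, `N_a g` is `C^∞`
(kernel-side differentiation, `FluidPDE/HarmonicProbe`). [folklore] -/
theorem contDiff_potential_pos (ha : 0 < a) (hg : Integrable g) (hsupp : ∀ z ∉ ball c R, g z = 0)
    (m : ℕ) : ContDiff ℝ m (potential a g) := by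
  have h := Literature.Analysis.FluidPDE.contDiff_integral_smul_comp_sub (F := ℝ) hg
    (fun z hz => eq_zero_of_norm_gt hsupp hz) m (contDiff_kernel ha (m := m))
  have e : potential a g = fun x => ∫ z, g z * kernel a (x - z) := rfl
  rw [e]
  simpa only [smul_eq_mul] using h

/-- For `a > 0`, `D(N_a g)(x) = ∫ g z • DΓ_a(x - z) dz`. [folklore] -/
theorem hasFDerivAt_potential_pos (ha : 0 < a) (hg : Integrable g)
    (hsupp : ∀ z ∉ ball c R, g z = 0) (x : E) :
    HasFDerivAt (potential a g) (potentialGrad a g x) x := by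
  have h := Literature.Analysis.FluidPDE.hasFDerivAt_integral_smul_comp_sub (F := ℝ) hg
    (fun z hz => eq_zero_of_norm_gt hsupp hz) (contDiff_kernel ha (m := 1)) x
  have e : potential a g = fun x => ∫ z, g z * kernel a (x - z) := rfl
  rw [e, potentialGrad]
  simpa only [smul_eq_mul] using h

/-- For `a > 0`, **`Δ (N_a g)(x) = ∫ g(z) ρ_a(x - z) dz`**. [folklore] -/
theorem laplacian_potential_pos (ha : 0 < a) (hg : Integrable g) (hsupp : ∀ z ∉ ball c R, g z = 0)
    (x : E) : (Δ (potential a g)) x = ∫ z, g z * approxId a (x - z) := by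
  have h := Literature.Analysis.FluidPDE.laplacian_integral_mul_comp_sub hg
    (fun z hz => eq_zero_of_norm_gt hsupp hz) (contDiff_kernel ha (m := 2)) x
  have e : (fun x => ∫ z, g z * kernel a (x - z)) = potential a g := rfl
  rw [e] at h
  rw [h]
  refine integral_congr_ae (Eventually.of_forall fun z => ?_)
  simp only [laplacian_kernel (base_pos_of_pos ha (x - z))]

/-- For `a > 0`, `potentialGrad a g` is the derivative of `N_a g`, hence continuous.
[folklore] -/
theorem continuous_potentialGrad_pos (ha : 0 < a) (hg : Integrable g)
    (hsupp : ∀ z ∉ ball c R, g z = 0) : Continuous (potentialGrad a g) := by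
  have h1 : fderiv ℝ (potential a g) = potentialGrad a g :=
    funext fun x => (hasFDerivAt_potential_pos ha hg hsupp x).fderiv
  rw [← h1]
  exact (contDiff_potential_pos ha hg hsupp 1).continuous_fderiv one_ne_zero

end Regularised

/-! ### Integrability of the potential integrands and sup bounds -/

section Bounds

variable {g : E → ℝ} {c : E} {R M : ℝ}

/-- Points are Haar-null (`n ≥ 1`): almost every `z` differs from `x`. [folklore] -/
theorem ae_ne (hn : 3 ≤ finrank ℝ E) (x : E) : ∀ᵐ z : E ∂volume, z ≠ x := by
  haveI : Nontrivial E := Module.nontrivial_of_finrank_pos (R := ℝ) (by omega)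
  exact measure_eq_zero_iff_ae_notMem.1 (measure_singleton x)

/-- Off the point `z = x`, `|g(z) Γ_a(x - z)| ≤ M A⁻¹ 1_{B(c,R)}(z) ‖x - z‖^{-(n-2)}`.
[folklore] -/
theorem abs_mul_kernel_le (hn : 3 ≤ finrank ℝ E) {a : ℝ} (ha : 0 ≤ a) (hgM : ∀ z, |g z| ≤ M)
    (hsupp : ∀ z ∉ ball c R, g z = 0) (x : E) {z : E} (hz : z ≠ x) :
    |g z * kernel a (x - z)| ≤
      M * (bumpMass E)⁻¹ * (ball c R).indicator (fun z => ‖x - z‖ ^ (-(2 * expo E))) z := by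
  have hM0 : 0 ≤ M := (abs_nonneg _).trans (hgM x)
  by_cases hzB : z ∈ ball c R
  · rw [indicator_of_mem hzB, abs_mul]
    have hxz : x - z ≠ 0 := sub_ne_zero.2 (Ne.symm hz)
    calc |g z| * |kernel a (x - z)| ≤ M * |kernel 0 (x - z)| :=
          mul_le_mul (hgM z) (abs_kernel_le_abs_kernel_zero (by omega) ha hxz) (abs_nonneg _) hM0
      _ = M * (bumpMass E)⁻¹ * ‖x - z‖ ^ (-(2 * expo E)) := by
          rw [abs_kernel_zero_eq hn, mul_assoc]
  · rw [hsupp z hzB, zero_mul, abs_zero, indicator_of_notMem hzB, mul_zero]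

/-- The dominating function `1_{B(c,R)} ‖x - z‖^{-(n-2)}` is integrable. [folklore] -/
theorem integrable_indicator_norm_sub_rpow (hn : 3 ≤ finrank ℝ E) (c x : E) (R : ℝ) {s : ℝ}
    (hs : s < finrank ℝ E) :
    Integrable ((ball c R).indicator fun z : E => ‖x - z‖ ^ (-s)) :=
  (integrableOn_norm_sub_rpow_neg hn hs x c R).integrable_indicator measurableSet_ball

/-- **Integrability of the potential integrand** `z ↦ g(z) Γ_a(x - z)` for a bounded
integrable density supported in a ball (`a ≥ 0`, `n ≥ 3`). [folklore] -/
theorem integrable_mul_kernel (hn : 3 ≤ finrank ℝ E) {a : ℝ} (ha : 0 ≤ a) (hg : Integrable g)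
    (hgM : ∀ z, |g z| ≤ M) (hsupp : ∀ z ∉ ball c R, g z = 0) (x : E) :
    Integrable fun z => g z * kernel a (x - z) := by
  have h2k : 2 * expo E < finrank ℝ E := by rw [two_mul_expo]; linarith
  refine (integrable_indicator_norm_sub_rpow hn c x R h2k).const_mul (M * (bumpMass E)⁻¹) |>.mono'
    (hg.aestronglyMeasurable.mul ?_) ?_
  · exact ((measurable_kernel a).comp (measurable_const.sub measurable_id)).aestronglyMeasurable
  · filter_upwards [ae_ne hn x] with z hz
    rw [Real.norm_eq_abs]
    exact abs_mul_kernel_le hn ha hgM hsupp x hz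

/-- **The sup bound `|N_a g (x)| ≤ (n/2 + 1)|B₁| A⁻¹ M R²`** for `|g| ≤ M` supported in
`B(c, R)`, `R > 0`, all `a ≥ 0` and all `x` (`n ≥ 3`). [folklore] -/
theorem abs_potential_le (hn : 3 ≤ finrank ℝ E) {a : ℝ} (ha : 0 ≤ a) (hg : Integrable g)
    (hgM : ∀ z, |g z| ≤ M) (hsupp : ∀ z ∉ ball c R, g z = 0) (hR : 0 < R) (x : E) :
    |potential a g x| ≤
      ((finrank ℝ E : ℝ) / 2 + 1) * (volume : Measure E).real (ball 0 1) * (bumpMass E)⁻¹ *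
        M * R ^ 2 := by
  have h2k : 2 * expo E < finrank ℝ E := by rw [two_mul_expo]; linarith
  have h2k0 : 0 ≤ 2 * expo E := by have := expo_pos hn; linarith
  have hM0 : 0 ≤ M := (abs_nonneg _).trans (hgM x)
  have hA : 0 < bumpMass E := bumpMass_pos hn
  have hae : ∀ᵐ z : E ∂volume, z ≠ x := ae_ne hn x
  have hdom := integrable_indicator_norm_sub_rpow hn c x R h2k
  unfold potential
  calc |∫ z, g z * kernel a (x - z)| ≤ ∫ z, |g z * kernel a (x - z)| := abs_integral_le_integral_abs
    _ ≤ ∫ z, M * (bumpMass E)⁻¹ * (ball c R).indicator (fun z => ‖x - z‖ ^ (-(2 * expo E))) z := by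
        refine integral_mono_ae (integrable_mul_kernel hn ha hg hgM hsupp x).abs
          (hdom.const_mul _) ?_
        filter_upwards [hae] with z hz using abs_mul_kernel_le hn ha hgM hsupp x hz
    _ = M * (bumpMass E)⁻¹ * ∫ z in ball c R, ‖x - z‖ ^ (-(2 * expo E)) := by
        rw [integral_const_mul, integral_indicator measurableSet_ball]
    _ ≤ M * (bumpMass E)⁻¹ * (((finrank ℝ E : ℝ) / ((finrank ℝ E : ℝ) - 2 * expo E) + 1) *
          (volume : Measure E).real (ball 0 1) * R ^ ((finrank ℝ E : ℝ) - 2 * expo E)) :=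
        mul_le_mul_of_nonneg_left (setIntegral_ball_norm_sub_rpow_neg_le hn h2k0 h2k c x hR)
          (by positivity)
    _ = ((finrank ℝ E : ℝ) / 2 + 1) * (volume : Measure E).real (ball 0 1) * (bumpMass E)⁻¹ *
          M * R ^ 2 := by
        rw [two_mul_expo, show (finrank ℝ E : ℝ) - ((finrank ℝ E : ℝ) - 2) = 2 by ring,
          show (R ^ (2 : ℝ)) = R ^ 2 by norm_cast]
        ring

/-- Off the point `z = x`, `‖g(z) • DΓ_a(x - z)‖ ≤ M (2k/A) 1_{B(c,R)}(z) ‖x - z‖^{-(n-1)}`.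
[folklore] -/
theorem norm_smul_fderiv_kernel_le (hn : 3 ≤ finrank ℝ E) {a : ℝ} (ha : 0 ≤ a)
    (hgM : ∀ z, |g z| ≤ M) (hsupp : ∀ z ∉ ball c R, g z = 0) (x : E) {z : E} (hz : z ≠ x) :
    ‖g z • fderiv ℝ (kernel a : E → ℝ) (x - z)‖ ≤
      M * (2 * expo E * (bumpMass E)⁻¹) *
        (ball c R).indicator (fun z => ‖x - z‖ ^ (-(2 * expo E + 1))) z := by
  have hM0 : 0 ≤ M := (abs_nonneg _).trans (hgM x)
  by_cases hzB : z ∈ ball c R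
  · rw [indicator_of_mem hzB, norm_smul, Real.norm_eq_abs]
    have hxz : x - z ≠ 0 := sub_ne_zero.2 (Ne.symm hz)
    calc |g z| * ‖fderiv ℝ (kernel a : E → ℝ) (x - z)‖
        ≤ M * (2 * expo E * (bumpMass E)⁻¹ * ‖x - z‖ ^ (-(2 * expo E + 1))) :=
          mul_le_mul (hgM z) (norm_fderiv_kernel_le hn ha hxz) (norm_nonneg _) hM0
      _ = M * (2 * expo E * (bumpMass E)⁻¹) * ‖x - z‖ ^ (-(2 * expo E + 1)) := by ring
  · rw [hsupp z hzB, zero_smul, norm_zero, indicator_of_notMem hzB, mul_zero]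

/-- The derivative kernel is measurable. [folklore] -/
theorem measurable_fderiv_kernel (a : ℝ) : Measurable (fderiv ℝ (kernel a : E → ℝ)) :=
  measurable_fderiv ℝ (kernel a : E → ℝ)

/-- **Integrability of the gradient-potential integrand** `z ↦ g(z) • DΓ_a(x - z)` (`a ≥ 0`,
`n ≥ 3`). [folklore] -/
theorem integrable_smul_fderiv_kernel (hn : 3 ≤ finrank ℝ E) {a : ℝ} (ha : 0 ≤ a)
    (hg : Integrable g) (hgM : ∀ z, |g z| ≤ M) (hsupp : ∀ z ∉ ball c R, g z = 0) (x : E) :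
    Integrable fun z => g z • fderiv ℝ (kernel a : E → ℝ) (x - z) := by
  have h2k1 : 2 * expo E + 1 < finrank ℝ E := by rw [two_mul_expo]; linarith
  refine (integrable_indicator_norm_sub_rpow hn c x R h2k1).const_mul
    (M * (2 * expo E * (bumpMass E)⁻¹)) |>.mono' (hg.aestronglyMeasurable.smul ?_) ?_
  · exact ((measurable_fderiv_kernel a).comp (measurable_const.sub measurable_id)).aestronglyMeasurable
  · filter_upwards [ae_ne hn x] with z hz using norm_smul_fderiv_kernel_le hn ha hgM hsupp x hz

/-- **The gradient bound `‖∫ g(z) • DΓ_a(x - z) dz‖ ≤ (n+1)|B₁| (2k/A) M R`** for `|g| ≤ M`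
supported in `B(c, R)`, `R > 0`, all `a ≥ 0`, all `x` (`n ≥ 3`). [folklore] -/
theorem norm_potentialGrad_le (hn : 3 ≤ finrank ℝ E) {a : ℝ} (ha : 0 ≤ a) (hg : Integrable g)
    (hgM : ∀ z, |g z| ≤ M) (hsupp : ∀ z ∉ ball c R, g z = 0) (hR : 0 < R) (x : E) :
    ‖potentialGrad a g x‖ ≤
      ((finrank ℝ E : ℝ) + 1) * (volume : Measure E).real (ball 0 1) *
        (2 * expo E * (bumpMass E)⁻¹) * M * R := by
  have h2k1 : 2 * expo E + 1 < finrank ℝ E := by rw [two_mul_expo]; linarith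
  have hk := expo_pos hn
  have h2k10 : 0 ≤ 2 * expo E + 1 := by linarith
  have hM0 : 0 ≤ M := (abs_nonneg _).trans (hgM x)
  have hA : 0 < bumpMass E := bumpMass_pos hn
  have hae : ∀ᵐ z : E ∂volume, z ≠ x := ae_ne hn x
  have hdom := integrable_indicator_norm_sub_rpow hn c x R h2k1
  unfold potentialGrad
  calc ‖∫ z, g z • fderiv ℝ (kernel a : E → ℝ) (x - z)‖
      ≤ ∫ z, ‖g z • fderiv ℝ (kernel a : E → ℝ) (x - z)‖ := norm_integral_le_integral_norm _
    _ ≤ ∫ z, M * (2 * expo E * (bumpMass E)⁻¹) *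
          (ball c R).indicator (fun z => ‖x - z‖ ^ (-(2 * expo E + 1))) z := by
        refine integral_mono_ae (integrable_smul_fderiv_kernel hn ha hg hgM hsupp x).norm
          (hdom.const_mul _) ?_
        filter_upwards [hae] with z hz using norm_smul_fderiv_kernel_le hn ha hgM hsupp x hz
    _ = M * (2 * expo E * (bumpMass E)⁻¹) * ∫ z in ball c R, ‖x - z‖ ^ (-(2 * expo E + 1)) := by
        rw [integral_const_mul, integral_indicator measurableSet_ball]
    _ ≤ M * (2 * expo E * (bumpMass E)⁻¹) *
          (((finrank ℝ E : ℝ) / ((finrank ℝ E : ℝ) - (2 * expo E + 1)) + 1) *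
          (volume : Measure E).real (ball 0 1) * R ^ ((finrank ℝ E : ℝ) - (2 * expo E + 1))) :=
        mul_le_mul_of_nonneg_left (setIntegral_ball_norm_sub_rpow_neg_le hn h2k10 h2k1 c x hR)
          (by positivity)
    _ = ((finrank ℝ E : ℝ) + 1) * (volume : Measure E).real (ball 0 1) *
          (2 * expo E * (bumpMass E)⁻¹) * M * R := by
        rw [two_mul_expo, show (finrank ℝ E : ℝ) - ((finrank ℝ E : ℝ) - 2 + 1) = 1 by ring,
          Real.rpow_one, div_one]
        ring

end Bounds

/-! ### N4. Harmonicity off the support -/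

section OffSupport

/-- A smooth "floor": `smoothFloor m s = s` for `s ≥ 2m`, `smoothFloor m s ≥ m` everywhere
(`m > 0`), smooth in `s` (built from Mathlib's `Real.smoothTransition`). [folklore] -/
def smoothFloor (m s : ℝ) : ℝ := m + (s - m) * Real.smoothTransition ((s - m) / m)

/-- `smoothFloor m s = s` for `s ≥ 2m` (`m > 0`). [folklore] -/
theorem smoothFloor_eq_self {m s : ℝ} (hm : 0 < m) (hs : 2 * m ≤ s) : smoothFloor m s = s := by
  unfold smoothFloor
  rw [Real.smoothTransition.one_of_one_le, mul_one, add_sub_cancel]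
  rw [le_div_iff₀ hm]; linarith

/-- `m ≤ smoothFloor m s` (`m > 0`). [folklore] -/
theorem le_smoothFloor {m : ℝ} (hm : 0 < m) (s : ℝ) : m ≤ smoothFloor m s := by
  unfold smoothFloor
  have : 0 ≤ (s - m) * Real.smoothTransition ((s - m) / m) := by
    rcases le_or_gt m s with h | h
    · exact mul_nonneg (by linarith) (Real.smoothTransition.nonneg _)
    · rw [Real.smoothTransition.zero_of_nonpos, mul_zero]
      exact div_nonpos_of_nonpos_of_nonneg (by linarith) hm.le
  linarith

/-- `smoothFloor m` is smooth. [folklore] -/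
theorem contDiff_smoothFloor (m : ℝ) {k : ℕ∞} : ContDiff ℝ k (smoothFloor m) := by
  unfold smoothFloor
  exact contDiff_const.add ((contDiff_id.sub contDiff_const).mul
    (Real.smoothTransition.contDiff.comp ((contDiff_id.sub contDiff_const).div_const m)))

/-- The SMOOTHED NEWTONIAN KERNEL `-A⁻¹ (smoothFloor m (‖ξ‖²))^{-k}`: smooth on `E` (`m > 0`) and
equal to `Γ` for `‖ξ‖² ≥ 2m`. [folklore] -/
def kernelFloor (m : ℝ) (ξ : E) : ℝ := -(bumpMass E)⁻¹ * (smoothFloor m (‖ξ‖ ^ 2)) ^ (-expo E)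

/-- `kernelFloor m` is smooth (`m > 0`). [folklore] -/
theorem contDiff_kernelFloor {m : ℝ} (hm : 0 < m) {k : ℕ} : ContDiff ℝ k (kernelFloor m : E → ℝ) := by
  unfold kernelFloor
  refine contDiff_const.mul ?_
  have h1 : ContDiff ℝ k fun ξ : E => smoothFloor m (‖ξ‖ ^ 2) :=
    (contDiff_smoothFloor m).comp (contDiff_norm_sq ℝ)
  exact h1.rpow_const_of_ne fun ξ => (hm.trans_le (le_smoothFloor hm (‖ξ‖ ^ 2))).ne'

/-- `kernelFloor m = Γ` on `{‖ξ‖² > 2m}`, an open set; hence they agree near each such point.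
[folklore] -/
theorem kernelFloor_eventuallyEq {m : ℝ} (hm : 0 < m) {ξ : E} (hξ : 2 * m < ‖ξ‖ ^ 2) :
    (kernelFloor m : E → ℝ) =ᶠ[𝓝 ξ] kernel 0 := by
  have ho : IsOpen {w : E | 2 * m < ‖w‖ ^ 2} := isOpen_lt continuous_const (by fun_prop)
  filter_upwards [ho.mem_nhds hξ] with w hw
  simp only [kernelFloor, kernel, regKernel, add_zero]
  rw [smoothFloor_eq_self hm (le_of_lt hw)]

/-- **N4. The Newtonian potential is smooth and harmonic off the support of the density**: if
the integrable density `g` vanishes on `B(x₀, r)`, then on `B(x₀, r/2)` the potential `N g` agrees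
with the smooth function `x ↦ ∫ g(z) Γ̃(x - z) dz` (`Γ̃ = kernelFloor (r²/8)`), is `C^∞` there, and
`Δ (N g) = 0`. [folklore] -/
theorem potential_eq_integral_kernelFloor {g : E → ℝ} {x₀ : E} {r : ℝ}
    (hr : 0 < r) (hg0 : ∀ z ∈ ball x₀ r, g z = 0) {x : E}
    (hx : x ∈ ball x₀ (r / 2)) :
    potential 0 g x = ∫ z, g z * kernelFloor (r ^ 2 / 8) (x - z) := by
  unfold potential
  refine integral_congr_ae (Eventually.of_forall fun z => ?_)
  by_cases hz : g z = 0
  · simp [hz]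
  · have hzr : r ≤ dist z x₀ := by
      by_contra h
      exact hz (hg0 z (by rwa [mem_ball, ← not_le]))
    have hxz : r / 2 < ‖x - z‖ := by
      rw [mem_ball] at hx
      have := dist_triangle z x x₀
      rw [dist_eq_norm z x, norm_sub_rev] at this
      linarith
    have h2m : 2 * (r ^ 2 / 8) ≤ ‖x - z‖ ^ 2 := by nlinarith
    simp only [kernelFloor, kernel, regKernel, add_zero]
    rw [smoothFloor_eq_self (by positivity) h2m]

/-- **N4 (continued)**: under the hypotheses of `potential_eq_integral_kernelFloor`, `N g` is
smooth on `B(x₀, r/2)` and `Δ (N g) = 0` there. [folklore] -/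
theorem laplacian_potential_eq_zero_of_forall_eq_zero {g : E → ℝ} {c x₀ : E} {R r : ℝ}
    (hg : Integrable g) (hsupp : ∀ z ∉ ball c R, g z = 0) (hr : 0 < r)
    (hg0 : ∀ z ∈ ball x₀ r, g z = 0) :
    ContDiffOn ℝ ∞ (potential 0 g) (ball x₀ (r / 2)) ∧
      ∀ x ∈ ball x₀ (r / 2), (Δ (potential 0 g)) x = 0 := by
  set m : ℝ := r ^ 2 / 8 with hm
  have hm0 : 0 < m := by positivity
  set P : E → ℝ := fun x => ∫ z, g z * kernelFloor m (x - z) with hP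
  have hρ : ∀ z : E, ‖c‖ + R < ‖z‖ → g z = 0 := fun z hz => eq_zero_of_norm_gt hsupp hz
  have hPs : ∀ k : ℕ, ContDiff ℝ k P := fun k => by
    have h := Literature.Analysis.FluidPDE.contDiff_integral_smul_comp_sub (F := ℝ) hg hρ k
      (contDiff_kernelFloor hm0 (k := k))
    simpa only [hP, smul_eq_mul] using h
  have heq : ∀ x ∈ ball x₀ (r / 2), potential 0 g x = P x := fun x hx =>
    potential_eq_integral_kernelFloor hr hg0 hx
  have heqOn : EqOn (potential 0 g) P (ball x₀ (r / 2)) := heq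
  refine ⟨?_, fun x hx => ?_⟩
  · have hPtop : ContDiffOn ℝ ∞ P (ball x₀ (r / 2)) := by
      rw [contDiffOn_infty]
      intro k
      exact (hPs k).contDiffOn
    exact hPtop.congr heqOn
  · have hev : potential 0 g =ᶠ[𝓝 x] P :=
      Filter.eventuallyEq_of_mem (isOpen_ball.mem_nhds hx) heqOn
    rw [(InnerProductSpace.laplacian_congr_nhds hev).eq_of_nhds]
    have hΔ := Literature.Analysis.FluidPDE.laplacian_integral_mul_comp_sub hg hρ
      (contDiff_kernelFloor hm0 (k := 2)) x
    rw [hP, hΔ]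
    refine integral_eq_zero_of_ae (Eventually.of_forall fun z => ?_)
    by_cases hz : g z = 0
    · simp [hz]
    · have hzr : r ≤ dist z x₀ := by
        by_contra h
        exact hz (hg0 z (by rwa [mem_ball, ← not_le]))
      have hxz : r / 2 < ‖x - z‖ := by
        rw [mem_ball] at hx
        have := dist_triangle z x x₀
        rw [dist_eq_norm z x, norm_sub_rev] at this
        linarith
      have h2m : 2 * m < ‖x - z‖ ^ 2 := by rw [hm]; nlinarith
      have hxz0 : x - z ≠ 0 := by
        intro h; rw [h, norm_zero] at hxz; linarith
      simp only [Pi.zero_apply]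
      rw [(InnerProductSpace.laplacian_congr_nhds (kernelFloor_eventuallyEq hm0 h2m)).eq_of_nhds,
        laplacian_kernel_zero hxz0, mul_zero]

end OffSupport

end Newtonian

end Literature.Analysis.PDE
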